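import Summits.AtomisticToContinuum.HydrodynamicLimit.Theses.OneFlightGossipEngine
import Literature.MathematicalPhysics.KineticTheory.HardSphereEulerProofs
import Literature.MathematicalPhysics.KineticTheory.VelocityBlindPlacement
import Literature.Analysis.FluidPDE.HardSphereFlowJointMeasurable
import Summits.AtomisticToContinuum.HydrodynamicLimit.Theorems.OneFlightGossipEngineKineticCurrentsWindowLDUniformLocalGibbsLedgerAssemblyPrelim
import Summits.AtomisticToContinuum.HydrodynamicLimit.Theorems.OneFlightGossipEngineKineticCurrentsWindowLDUniformLedgerAssemblyDuality
import Summits.AtomisticToContinuum.HydrodynamicLimit.Theorems.OneFlightGossipEngineKineticCurrentsWindowLDUniformLedgerAssemblyStatics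
import Summits.AtomisticToContinuum.HydrodynamicLimit.Theorems.OneFlightGossipEngineKineticCurrentsWindowLDUniformForecastIncrement
import Summits.AtomisticToContinuum.HydrodynamicLimit.Theorems.OneFlightGossipEngineKineticCurrentsWindowLDUniformAssembly
import HarnessLib

/-!
# Ledger assembly for the crux `KineticCurrentsWindowLDUniform` (stmt-AtomisticToContinuum-14662),
# line `local-gibbs-entropy-ledger` — registered stub `stub_localGibbsLedgerAssemblyByName` (S7')

The ASSEMBLY of the line skeleton `Cruxes/KineticCurrentsWindowLDUniform/Lines/local_gibbs_entropy_ledger.lean`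
in named form: the one-body entropy ledger (H1, conclusion of S2), the marginal entropy ledger (H2, S3),
entropy-level quasi-invariance over a kinetic window (H3, conclusion of S5) and the residual integrated
kinetic-entropy bound `C⁺` (H4, S6) imply the crux `OneFlightGossipEngine.KineticCurrentsWindowLDUniform`
BY NAME, with the `η₀ ≤ 1/8` of `C⁺`.  Pure bookkeeping (the chain is spelled out in the theorem's
docstring): guard ⇒ `σ ≤ 1/2`; STATIC `β₀ := min β₁ (min (1/(4Kc)) (c₀/4))` chosen before `ε`
(`c₀` from `KineticCurrentsWindowLDUniformGossip.LedgerAssembly.static_expMoment`); `Q := λ.tilted (βS)`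
and the Gibbs variational identity (`LedgerAssembly.klDiv_tilted_eq`); the energy is `Q`-integrable
(`ForecastIncrement.integrable_exp_mul_energy`, `LedgerAssembly.integrable_tilted_of_exp_moments`) so the
window-mean identity of the helper file `…LocalGibbsLedgerAssemblyPrelim` applies; per `r ∈ [0,w]` the
ledgers H2 (at `P := Q ∘ Φ_r⁻¹`, `Measure.map_map`, `localGibbsLaw_eq`), H3, H1 at the one-time one-body
marginal `f̄_r`; integration over `r` in `ℝ≥0∞` and H4; arithmetic
`log ∫e^{βS}dλ /(N+1) ≤ h(|β|Kc + |β|Lε' − 1) + |β|Kδ + |β|Lε' ≤ ε`.  The frame (guard, final `∫⁻`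
conversion) is adapted from the gossip line's `KineticCurrentsWindowLDUniformGossip.stub_ledgerAssembly_core`.

References: C. Kipnis, C. Landim, *Scaling Limits of Interacting Particle Systems* (1999), Ch. 6 and
App. 1 §8 (relative entropy method, entropy inequality, Gibbs variational principle); H. Spohn,
*Large Scale Dynamics of Interacting Particles* (1991), Part I §2.3 (local Gibbs laws).
-/

noncomputable section

open MeasureTheory Set Filter InformationTheory ProbabilityTheory
open scoped ENNReal Topology

namespace Summit.AtomisticToContinuum.HydrodynamicLimit.Theorems.KineticCurrentsWindowLDUniformLocalGibbs

open Literature.Analysis.FluidPDE (HardSphereFlow Config localMaxwellian canonicalDensity liouville)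
open Literature.MathematicalPhysics.KineticTheory (T3 V3 hsDiameter localGibbsLaw localGibbsMeasure
  localGibbsProfile gaussMeasure isProbabilityMeasure_localGibbsLaw localGibbsLaw_eq)
open Summit.AtomisticToContinuum.HydrodynamicLimit.Theses.OneFlightGossipEngine
  (KineticCurrentsWindowLDUniform)
open Literature.MathematicalPhysics.KineticTheory.VelocityBlindPlacement (Flow)
open Summit.AtomisticToContinuum.HydrodynamicLimit.Theorems.KineticCurrentsWindowLDUniformSketch
  (integral_le_iSup_T3)
open Summit.AtomisticToContinuum.HydrodynamicLimit.Theorems.KineticCurrentsWindowLDUniformGossip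
  (LedgerAssembly.static_expMoment LedgerAssembly.klDiv_tilted_eq
    LedgerAssembly.integrable_tilted_of_exp_moments ForecastIncrement.integrable_exp_mul_energy)

/-- S7' — THE LEDGER ASSEMBLY, NAMED FORM (L; the form the lead asks the S7 worker to land; registered as an
independent stub placed AFTER `_of` so that the skeleton audit still takes `_of` as the composition; once landed
under Theorems it REPLACES S7 in `_of` — `_of := stub_localGibbsLedgerAssemblyByName (S2 S1) S3 (S5 S4) S6`.
Reshaped by the lead, chain c2, from S7: same hypotheses H1–H3, but H4 is now the residual `C⁺` in
its registered `∃ η₀ ≤ 1/8` form — verbatim the statement of `stub_integratedKineticEntropyBound` — and the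
conclusion is the crux BY NAME, so that the registered signature stays under the registry's 4000-character
cap; flows are spelled with the tree abbreviation `VelocityBlindPlacement.Flow σ N =
HardSphereFlow (Torus.geometry (Fin 3)) (hsDiameter σ N) (N + 1)`, reducibly equal to the long form used by
S5/S6). Hypotheses: the one-body ledger (conclusion of S2), the marginal ledger (S3), entropy
quasi-invariance (conclusion of S5), and `C⁺` (S6); conclusion: the crux (with the `η₀` of `C⁺`).
THE CHAIN, for `|β| ≤ β₀ := min(β₁, 1/(4Kc), c₀/4)` (`c₀` the static exponential-moment threshold of
`KineticCurrentsWindowLDUniformGossip.stub_ledgerAssembly_statics`, p99970), `ε > 0`: `σ ≤ 1/2` from the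
guard and `η₀ ≤ 1/8` (`∫a ≤ sup a`, Haar probability volume of `𝕋³`); `e^{βS} ∈ L¹(λ^N)` and
`S e^{βS} ∈ L¹` (statics); `Q := λ^N.tilted(βS)` is a probability measure and
`log ∫e^{βS}dλ^N = βE_Q S − KL(Q‖λ^N)` (`KineticCurrentsWindowLDUniformGossip.LedgerAssembly.klDiv_tilted_eq`,
p99969); `E_Q S = (N+1) w⁻¹∫₀ʷ ∫F df̄_r dr` (Fubini over `HardSphereFlowJointMeasurable`, pathwise
integrability `KineticCurrentsWindowLDUniformSketch.stub_pathwiseWindow` p86158, `integral_map`); per `r ∈ [0,w]`: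
`ofReal|∫F df̄_r| ≤ K·𝓗(f̄_r) + L·𝒦(f̄_r)` (H1), `(N+1)𝓗(f̄_r) ≤ KL(Q∘Φ_r⁻¹‖λ^N)` (H2 with
`P := Q.map (Φ_r)`, `Measure.map_map`, `localGibbsLaw_eq`), `KL(Q∘Φ_r⁻¹‖λ^N) ≤ c·KL(Q‖λ^N) + δ(N+1)` (H3),
`w⁻¹∫⁻𝒦(f̄_r)dr ≤ ε'(h+1)` (H4), `h := KL(Q‖λ^N)/(N+1) ∈ [0,∞)`; integrate the per-`r` bound in `ℝ≥0∞`
(`lintegral_add_left` with the constant summand measurable), hence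
`log∫e^{βS}/(N+1) ≤ h(|β|Kc + |β|Lε' − 1) + |β|Kδ + |β|Lε' ≤ ε` once `ε' := min 1 (ε/2) / (4(β₀L + 1))`,
`δ := ε/(2(β₀K + 1))` (`τ := τ_{C⁺}(β, ε')`, `N₀ := max`). Quantifier order `∃β₀ ∀β ∀ε ∃τ ∃N₀` as in the crux. -/
theorem stub_localGibbsLedgerAssemblyByName :
    (∀ (θ₀ : T3 → ℝ) (u₀ : T3 → V3), Continuous θ₀ → Continuous u₀ → (∀ x, 0 < θ₀ x) →
      ∀ (F : T3 × V3 → ℝ), Continuous F → ∀ C : ℝ, (∀ y, |F y| ≤ C * (1 + ‖y.2‖ ^ 2)) →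
      (∀ x, ∫ v, F (x, v) * localMaxwellian 1 (θ₀ x) (u₀ x) v = 0) →
      (∀ x (j : Fin 3), ∫ v, F (x, v) * v j * localMaxwellian 1 (θ₀ x) (u₀ x) v = 0) →
      (∀ x, ∫ v, F (x, v) * ‖v‖ ^ 2 * localMaxwellian 1 (θ₀ x) (u₀ x) v = 0) →
      ∃ K : ℝ, 0 < K ∧ ∃ L : ℝ, 0 < L ∧ ∀ (f : Measure (T3 × V3)) [IsProbabilityMeasure f],
        ENNReal.ofReal |∫ y, F y ∂f| ≤
          ENNReal.ofReal K * ∫⁻ x, klDiv (f.condKernel x) (gaussMeasure (u₀ x) (θ₀ x)) ∂f.fst +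
          ENNReal.ofReal L *
            ∫⁻ x, (⨅ (u : V3) (θ : ℝ) (_ : 0 < θ), klDiv (f.condKernel x) (gaussMeasure u θ)) ^ (1 / 2 : ℝ)
              ∂f.fst) →
    (∀ (a θ₀ : T3 → ℝ) (u₀ : T3 → V3), Continuous a → Continuous θ₀ → Continuous u₀ →
      (∀ x, 0 < a x) → (∀ x, 0 < θ₀ x) → ∀ σ : ℝ, 0 < σ → σ ≤ 1 / 2 → ∀ N : ℕ,
      ∀ (P : Measure (Config (N + 1) (Fin 3) T3)) [IsProbabilityMeasure P],
      ∀ (fbar : Measure (T3 × V3)) [IsProbabilityMeasure fbar],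
        fbar = ((N : ℝ≥0∞) + 1)⁻¹ • ∑ i : Fin (N + 1), P.map (fun z => z i) →
        ((N : ℝ≥0∞) + 1) * ∫⁻ x, klDiv (fbar.condKernel x) (gaussMeasure (u₀ x) (θ₀ x)) ∂fbar.fst ≤
          klDiv P (localGibbsMeasure σ a u₀ θ₀ N)) →
    (∀ (a θ₀ : T3 → ℝ) (u₀ : T3 → V3), Continuous a → Continuous θ₀ → Continuous u₀ →
      (∀ x, 0 < a x) → (∀ x, 0 < θ₀ x) → ∀ σ : ℝ, 0 < σ → σ ≤ 1 / 2 →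
      ∃ c : ℝ, 1 ≤ c ∧ ∀ τ : ℝ, 0 < τ → ∀ δ : ℝ, 0 < δ → ∀ Φ : (N : ℕ) → Flow σ N,
      ∃ N₀ : ℕ, ∀ N : ℕ, N₀ ≤ N → ∀ r ∈ Set.Icc (0 : ℝ) (τ * ((N : ℝ) + 1) ^ (-(1 / 3 : ℝ))),
      ∀ (P : Measure (Config (N + 1) (Fin 3) T3)) [IsProbabilityMeasure P],
        klDiv (P.map ((Φ N).flow r)) (localGibbsLaw σ a u₀ θ₀ N (Φ N)) ≤
          ENNReal.ofReal c * klDiv P (localGibbsLaw σ a u₀ θ₀ N (Φ N)) +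
            ENNReal.ofReal (δ * ((N : ℝ) + 1))) →
    (∃ η₀ : ℝ, 0 < η₀ ∧ η₀ ≤ 1 / 8 ∧
    ∀ (a θ₀ : T3 → ℝ) (u₀ : T3 → V3), Continuous a → Continuous θ₀ → Continuous u₀ →
      (∀ x, 0 < a x) → (∀ x, 0 < θ₀ x) → ∀ σ : ℝ, 0 < σ → σ ^ 3 * (⨆ x, a x) ≤ η₀ * ∫ x, a x →
      ∀ Φ : (N : ℕ) → Flow σ N,
      ∀ (A : T3 → Fin 3 → Fin 3 → ℝ) (b : T3 → V3) (G : T3 × ℝ → ℝ),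
      Continuous A → Continuous b → Continuous G →
      ∀ (F : T3 × V3 → ℝ), (∀ y, F y =
        (∑ j : Fin 3, ∑ k : Fin 3, A y.1 j k * ((y.2 - u₀ y.1) j * (y.2 - u₀ y.1) k)) +
          (∑ j : Fin 3, b y.1 j * (y.2 - u₀ y.1) j) * G (y.1, ‖y.2 - u₀ y.1‖ ^ 2)) →
      ∀ C : ℝ, (∀ y, |F y| ≤ C * (1 + ‖y.2‖ ^ 2)) →
      (∀ x, ∫ v, F (x, v) * localMaxwellian 1 (θ₀ x) (u₀ x) v = 0) →
      (∀ x (j : Fin 3), ∫ v, F (x, v) * v j * localMaxwellian 1 (θ₀ x) (u₀ x) v = 0) →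
      (∀ x, ∫ v, F (x, v) * ‖v‖ ^ 2 * localMaxwellian 1 (θ₀ x) (u₀ x) v = 0) →
      ∃ β₁ : ℝ, 0 < β₁ ∧ ∀ β : ℝ, |β| ≤ β₁ → ∀ ε' : ℝ, 0 < ε' → ∃ τ : ℝ, 0 < τ ∧ ∃ N₀ : ℕ, ∀ N : ℕ, N₀ ≤ N →
      ∀ (Q : Measure (Config (N + 1) (Fin 3) T3)) [IsProbabilityMeasure Q],
        Q = (localGibbsLaw σ a u₀ θ₀ N (Φ N)).tilted (fun z => β * ∑ i : Fin (N + 1),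
              (τ * ((N : ℝ) + 1) ^ (-(1 / 3 : ℝ)))⁻¹ *
                ∫ r in (0 : ℝ)..(τ * ((N : ℝ) + 1) ^ (-(1 / 3 : ℝ))), F (((Φ N).flow r z) i)) →
      ∀ (fbar : ℝ → Measure (T3 × V3)) [∀ r, IsProbabilityMeasure (fbar r)],
        (∀ r, fbar r = ((N : ℝ≥0∞) + 1)⁻¹ • ∑ i : Fin (N + 1), Q.map (fun z => ((Φ N).flow r z) i)) →
        (ENNReal.ofReal (τ * ((N : ℝ) + 1) ^ (-(1 / 3 : ℝ))))⁻¹ *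
            ∫⁻ r in Set.Icc (0 : ℝ) (τ * ((N : ℝ) + 1) ^ (-(1 / 3 : ℝ))),
              ∫⁻ x, (⨅ (u : V3) (θ : ℝ) (_ : 0 < θ),
                  klDiv ((fbar r).condKernel x) (gaussMeasure u θ)) ^ (1 / 2 : ℝ) ∂(fbar r).fst ≤
          ENNReal.ofReal ε' *
            (klDiv Q (localGibbsLaw σ a u₀ θ₀ N (Φ N)) / ((N : ℝ≥0∞) + 1) + 1)) →
    KineticCurrentsWindowLDUniform := by
  intro hH1 hH2 hH3 hH4
  obtain ⟨η₀, hη₀, hη8, hCplus⟩ := hH4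
  refine ⟨η₀, hη₀, ?_⟩
  intro a θ₀ u₀ ha hθ hu ha0 hθ0 σ hσ hguard Φ A b G hA hb hG hgrowth h1 hv h2
  obtain ⟨C, hC⟩ := hgrowth
  /- the functional of the crux -/
  set F : T3 × V3 → ℝ := fun y =>
    (∑ j : Fin 3, ∑ k : Fin 3, A y.1 j k * ((y.2 - u₀ y.1) j * (y.2 - u₀ y.1) k)) +
      (∑ j : Fin 3, b y.1 j * (y.2 - u₀ y.1) j) * G (y.1, ‖y.2 - u₀ y.1‖ ^ 2) with hFdef
  have hFc : Continuous F := by rw [hFdef]; fun_prop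
  have hC0 : 0 ≤ C := by
    have h := (abs_nonneg _).trans (hC 0)
    simpa using h
  /- (i) the activity guard gives `σ ≤ 1/2` (adapted from `KineticCurrentsWindowLDUniformGossip.stub_ledgerAssembly`) -/
  have hint_le : ∫ x, a x ≤ ⨆ x, a x := integral_le_iSup_T3 ha
  have hint_nn : 0 ≤ ∫ x, a x := integral_nonneg fun x => (ha0 x).le
  have hsup_pos : 0 < ⨆ x, a x := lt_of_lt_of_le (ha0 0) (le_ciSup (isCompact_range ha).bddAbove 0)
  have hσ2 : σ ≤ 1 / 2 := by
    have h8 : σ ^ 3 * (⨆ x, a x) ≤ 1 / 8 * (⨆ x, a x) :=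
      hguard.trans ((mul_le_mul_of_nonneg_right hη8 hint_nn).trans
        (mul_le_mul_of_nonneg_left hint_le (by norm_num)))
    have h8' : σ ^ 3 ≤ (1 / 2) ^ 3 := by nlinarith [hsup_pos]
    exact le_of_pow_le_pow_left₀ (by norm_num) (by norm_num) h8'
  /- (ii) the static constants `K, L, c, β₁, c₀` and the Gaussian parameter `s` -/
  obtain ⟨K, hK, L, hL, hLedger1⟩ := hH1 θ₀ u₀ hθ hu hθ0 F hFc C hC h1 hv h2
  obtain ⟨c, hc1, hQI⟩ := hH3 a θ₀ u₀ ha hθ hu ha0 hθ0 σ hσ hσ2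
  have hc0 : 0 < c := by linarith
  obtain ⟨β₁, hβ₁, hCp⟩ :=
    hCplus a θ₀ u₀ ha hθ hu ha0 hθ0 σ hσ hguard Φ A b G hA hb hG F (fun y => rfl) C hC h1 hv h2
  obtain ⟨c₀, hc₀, hstat⟩ := LedgerAssembly.static_expMoment ha hθ hu ha0 hθ0 hσ hσ2 hFc hC
  have hΘbdd : BddAbove (Set.range θ₀) := (isCompact_range hθ).bddAbove
  set Θ : ℝ := ⨆ x, θ₀ x with hΘdef
  have hθle : ∀ x, θ₀ x ≤ Θ := fun x => le_ciSup hΘbdd x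
  have hΘ0 : 0 < Θ := lt_of_lt_of_le (hθ0 0) (hθle 0)
  set s : ℝ := 1 / (8 * Θ) with hsdef
  have hs0 : 0 < s := by positivity
  have hsθ : ∀ x, 8 * s * θ₀ x ≤ 1 := by
    intro x
    calc 8 * s * θ₀ x ≤ 8 * s * Θ := mul_le_mul_of_nonneg_left (hθle x) (by positivity)
      _ = 1 := by rw [hsdef]; field_simp
  /- `β₀`, STATIC -/
  set β₀ : ℝ := min β₁ (min (1 / (4 * K * c)) (c₀ / 4)) with hβ₀def
  have hβ₀pos : 0 < β₀ := lt_min hβ₁ (lt_min (by positivity) (by positivity))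
  refine ⟨β₀, hβ₀pos, ?_⟩
  intro β hβ ε hε
  have hβ₀1 : |β| ≤ β₁ := hβ.trans (min_le_left _ _)
  have hβKc : |β| * (K * c) ≤ 1 / 4 := by
    have h := hβ.trans ((min_le_right _ _).trans (min_le_left _ _))
    rw [le_div_iff₀ (by positivity)] at h
    linarith
  have hβc₀ : 4 * |β| ≤ c₀ := by
    have h := hβ.trans ((min_le_right _ _).trans (min_le_right _ _))
    linarith
  /- (iii) `ε'`, `δ`, then `τ`, `N₀` -/
  set ε' : ℝ := min 1 (ε / 2) / (4 * (β₀ * L + 1)) with hε'def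
  have hε'pos : 0 < ε' := by positivity
  set δ : ℝ := ε / (2 * (β₀ * K + 1)) with hδdef
  have hδpos : 0 < δ := by positivity
  have hβL : |β| * L ≤ β₀ * L := mul_le_mul_of_nonneg_right hβ hL.le
  have hβK : |β| * K ≤ β₀ * K := mul_le_mul_of_nonneg_right hβ hK.le
  have hε'1 : (β₀ * L + 1) * ε' ≤ 1 / 4 := by
    rw [hε'def]
    have : (β₀ * L + 1) * (min 1 (ε / 2) / (4 * (β₀ * L + 1))) = min 1 (ε / 2) / 4 := by
      field_simp
    rw [this]
    linarith [min_le_left (1 : ℝ) (ε / 2)]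
  have hε'2 : (β₀ * L + 1) * ε' ≤ ε / 8 := by
    rw [hε'def]
    have : (β₀ * L + 1) * (min 1 (ε / 2) / (4 * (β₀ * L + 1))) = min 1 (ε / 2) / 4 := by
      field_simp
    rw [this]
    linarith [min_le_right (1 : ℝ) (ε / 2)]
  have hβLε1 : |β| * L * ε' ≤ 1 / 4 := by nlinarith
  have hβLε2 : |β| * L * ε' ≤ ε / 8 := by nlinarith
  have hβKδ : |β| * K * δ ≤ ε / 2 := by
    have : (β₀ * K + 1) * δ = ε / 2 := by rw [hδdef]; field_simp
    nlinarith
  obtain ⟨τ, hτ, N₁, hN₁⟩ := hCp β hβ₀1 ε' hε'pos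
  obtain ⟨N₂, hN₂⟩ := hQI τ hτ δ hδpos Φ
  refine ⟨τ, hτ, max N₁ N₂, fun N hN => ?_⟩
  have hN1 : N₁ ≤ N := le_of_max_le_left hN
  have hN2 : N₂ ≤ N := le_of_max_le_right hN
  /- fixed `N`: window, law, functional -/
  set w : ℝ := τ * ((N : ℝ) + 1) ^ (-(1 / 3 : ℝ)) with hwdef
  have hw : 0 < w := by positivity
  have hNpos : (0 : ℝ) < (N : ℝ) + 1 := by positivity
  set P : Measure (Config (N + 1) (Fin 3) T3) := localGibbsLaw σ a u₀ θ₀ N (Φ N) with hPdef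
  haveI hPprob : IsProbabilityMeasure P := isProbabilityMeasure_localGibbsLaw ha hθ hu ha0 hθ0 hσ2 N (Φ N)
  have hPgood : P (Φ N).goodᶜ = 0 := by
    have hPac : P ≪ liouville (Literature.Analysis.FluidPDE.Torus.geometry (Fin 3)) (N + 1) (hsDiameter σ N) := by
      rw [hPdef, Literature.MathematicalPhysics.KineticTheory.localGibbsLaw,
        Literature.Analysis.FluidPDE.particleLaw_eq]
      exact withDensity_absolutelyContinuous _ _
    exact hPac (Φ N).measure_compl_good
  set S : Config (N + 1) (Fin 3) T3 → ℝ :=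
    fun z => ∑ i, w⁻¹ * ∫ r in (0 : ℝ)..w, F (((Φ N).flow r z) i) with hSdef
  have hSm : AEStronglyMeasurable S P := by
    refine (Finset.aemeasurable_fun_sum (Finset.univ : Finset (Fin (N + 1))) fun i _ => ?_).aestronglyMeasurable
    exact ((Φ N).aemeasurable_intervalIntegral_comp_flow_torus (f := fun z => F (z i))
      (hFc.measurable.comp (measurable_pi_apply i)) 0 w hPgood).const_mul _
  /- (iv) statics and the tilted law -/
  have hexpS : ∀ c' : ℝ, 0 ≤ c' → c' ≤ c₀ → Integrable (fun z => Real.exp (c' * |S z|)) P := by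
    intro c' h0 h1'
    have hne := hstat c' h0 h1' N (Φ N) Finset.univ w hw
    have hm : AEStronglyMeasurable (fun z => Real.exp (c' * |S z|)) P :=
      (by fun_prop : Continuous fun x : ℝ => Real.exp (c' * |x|)).comp_aestronglyMeasurable hSm
    exact (lintegral_ofReal_ne_top_iff_integrable hm (ae_of_all _ fun _ => (Real.exp_pos _).le)).1 hne
  have hexp_le : ∀ c' : ℝ, |c'| ≤ c₀ → Integrable (fun z => Real.exp (c' * S z)) P := by
    intro c' hc'
    refine (hexpS |c'| (abs_nonneg _) hc').mono'
      (Real.continuous_exp.comp_aestronglyMeasurable (hSm.const_mul c')) (ae_of_all _ fun z => ?_)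
    rw [Real.norm_eq_abs, abs_of_pos (Real.exp_pos _)]
    refine Real.exp_le_exp.2 ?_
    rw [← abs_mul]
    exact le_abs_self _
  have hexpβ : Integrable (fun z => Real.exp (β * S z)) P :=
    hexp_le β (by linarith [abs_nonneg β])
  have hexp2β : Integrable (fun z => Real.exp (2 * (β * S z))) P := by
    have h := hexp_le (2 * β) (by rw [abs_mul, abs_two]; linarith [abs_nonneg β])
    exact h.congr (ae_of_all _ fun z => by simp only [mul_assoc])
  set Q : Measure (Config (N + 1) (Fin 3) T3) := P.tilted (fun z => β * S z) with hQdef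
  haveI hQprob : IsProbabilityMeasure Q := isProbabilityMeasure_tilted hexpβ
  have hQac : Q ≪ P := tilted_absolutelyContinuous P _
  have hQgood : Q (Φ N).goodᶜ = 0 := hQac hPgood
  have hSQ : Integrable S Q := by
    refine LedgerAssembly.integrable_tilted_of_exp_moments hexpβ hexp2β hSm (half_pos hc₀) ?_
    rw [show 2 * (c₀ / 2) = c₀ by ring]
    exact hexpS c₀ hc₀.le le_rfl
  obtain ⟨hKLfin, hKLeq⟩ := LedgerAssembly.klDiv_tilted_eq hexpβ (hSQ.const_mul β)
  set KL : ℝ := (klDiv Q P).toReal with hKLdef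
  have hKL0 : 0 ≤ KL := ENNReal.toReal_nonneg
  have hKLof : klDiv Q P = ENNReal.ofReal KL := (ENNReal.ofReal_toReal hKLfin).symm
  clear_value KL
  set h : ℝ := KL / ((N : ℝ) + 1) with hhdef
  have hh0 : 0 ≤ h := div_nonneg hKL0 hNpos.le
  have hKLh : KL = ((N : ℝ) + 1) * h := by rw [hhdef]; field_simp
  /- the energy is `Q`-integrable -/
  set E : Config (N + 1) (Fin 3) T3 → ℝ := fun z => ∑ j, ‖(z j).2‖ ^ 2 with hEdef
  have hEc : Continuous E := by rw [hEdef]; fun_prop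
  have hE0 : ∀ z, 0 ≤ E z := fun z => Finset.sum_nonneg fun j _ => sq_nonneg _
  have hexpE : Integrable (fun z => Real.exp (s * E z)) P :=
    ForecastIncrement.integrable_exp_mul_energy ha hθ hu ha0 hθ0 hσ hσ2 hs0.le hsθ N (Φ N)
  have hEQ : Integrable E Q := by
    refine LedgerAssembly.integrable_tilted_of_exp_moments hexpβ hexp2β hEc.aestronglyMeasurable
      (half_pos hs0) (hexpE.congr (ae_of_all _ fun z => ?_))
    simp only []
    rw [abs_of_nonneg (hE0 z)]
    ring_nf
  /- (v) the one-time one-body marginals `fbar r` and the window mean -/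
  have hmeas_i : ∀ (r : ℝ) (i : Fin (N + 1)),
      Measurable (fun z : Config (N + 1) (Fin 3) T3 => ((Φ N).flow r z) i) :=
    fun r i => (measurable_pi_apply i).comp ((Φ N).measurable_flow r)
  set fbar : ℝ → Measure (T3 × V3) :=
    fun r => ((N : ℝ≥0∞) + 1)⁻¹ • ∑ i : Fin (N + 1), Q.map (fun z => ((Φ N).flow r z) i) with hfbardef
  haveI hfbarprob : ∀ r, IsProbabilityMeasure (fbar r) := by
    intro r
    haveI : ∀ i, IsProbabilityMeasure (Q.map (fun z => ((Φ N).flow r z) i)) :=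
      fun i => Measure.isProbabilityMeasure_map (hmeas_i r i).aemeasurable
    exact lga_isProbabilityMeasure_avg _
  have hφ : ∀ r, ∫ y, F y ∂(fbar r) = ((N : ℝ) + 1)⁻¹ * ∑ i, ∫ z, F (((Φ N).flow r z) i) ∂Q := by
    intro r
    have hint_i : ∀ i, Integrable F (Q.map (fun z => ((Φ N).flow r z) i)) := fun i =>
      (integrable_map_measure hFc.aestronglyMeasurable (hmeas_i r i).aemeasurable).2
        (lga_integrable_obs_flow (Φ N) hFc hC0 hC hQgood hEQ r i)
    show ∫ y, F y ∂(((N : ℝ≥0∞) + 1)⁻¹ • ∑ i : Fin (N + 1), Q.map (fun z => ((Φ N).flow r z) i)) = _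
    rw [lga_integral_avg _ hint_i]
    congr 1
    refine Finset.sum_congr rfl fun i _ => ?_
    exact integral_map (hmeas_i r i).aemeasurable hFc.aestronglyMeasurable
  have hmean : ∫ z, S z ∂Q = w⁻¹ * (((N : ℝ) + 1) * ∫ r in (0 : ℝ)..w, ∫ y, F y ∂(fbar r)) := by
    have hm : ∫ z, S z ∂Q = w⁻¹ * ∫ r in (0 : ℝ)..w, ∑ i, ∫ z, F (((Φ N).flow r z) i) ∂Q :=
      stub_localGibbsLedgerAssemblyByName_prelim σ N (Φ N) F hFc C hC0 hC Q hQgood hEQ w hw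
    rw [hm, ← intervalIntegral.integral_const_mul ((N : ℝ) + 1)]
    congr 1
    refine intervalIntegral.integral_congr fun r _ => ?_
    rw [hφ r, ← mul_assoc, mul_inv_cancel₀ hNpos.ne', one_mul]
  /- (vi) the per-`r` ledger -/
  set 𝒦 : ℝ → ℝ≥0∞ := fun r => ∫⁻ x, (⨅ (u : V3) (θ : ℝ) (_ : 0 < θ),
      klDiv ((fbar r).condKernel x) (gaussMeasure u θ)) ^ (1 / 2 : ℝ) ∂(fbar r).fst with h𝒦def
  have hper : ∀ r ∈ Icc (0 : ℝ) w, ENNReal.ofReal |∫ y, F y ∂(fbar r)| ≤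
      ENNReal.ofReal (K * (c * h + δ)) + ENNReal.ofReal L * 𝒦 r := by
    intro r hr
    haveI : IsProbabilityMeasure (Q.map ((Φ N).flow r)) :=
      Measure.isProbabilityMeasure_map ((Φ N).measurable_flow r).aemeasurable
    have hfbar_eq : fbar r =
        ((N : ℝ≥0∞) + 1)⁻¹ • ∑ i : Fin (N + 1), (Q.map ((Φ N).flow r)).map (fun z => z i) := by
      show ((N : ℝ≥0∞) + 1)⁻¹ • ∑ i : Fin (N + 1), Q.map (fun z => ((Φ N).flow r z) i) = _
      congr 1
      refine Finset.sum_congr rfl fun i _ => ?_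
      rw [Measure.map_map (measurable_pi_apply i) ((Φ N).measurable_flow r)]
      rfl
    have h2r := hH2 a θ₀ u₀ ha hθ hu ha0 hθ0 σ hσ hσ2 N (Q.map ((Φ N).flow r)) (fbar r) hfbar_eq
    rw [← localGibbsLaw_eq σ a u₀ θ₀ N (Φ N)] at h2r
    have h2r' : ((N : ℝ≥0∞) + 1) *
        ∫⁻ x, klDiv ((fbar r).condKernel x) (gaussMeasure (u₀ x) (θ₀ x)) ∂(fbar r).fst ≤
        klDiv (Q.map ((Φ N).flow r)) P := h2r
    have h3r : klDiv (Q.map ((Φ N).flow r)) P ≤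
        ENNReal.ofReal c * klDiv Q P + ENNReal.ofReal (δ * ((N : ℝ) + 1)) :=
      hN₂ N hN2 r hr Q
    rw [hKLof] at h3r
    have hH : ∫⁻ x, klDiv ((fbar r).condKernel x) (gaussMeasure (u₀ x) (θ₀ x)) ∂(fbar r).fst ≤
        ENNReal.ofReal (c * h + δ) := lga_marginal_bound hc0.le hδpos.le hKL0 h2r' h3r
    have h1r : ENNReal.ofReal |∫ y, F y ∂(fbar r)| ≤
        ENNReal.ofReal K * ∫⁻ x, klDiv ((fbar r).condKernel x) (gaussMeasure (u₀ x) (θ₀ x)) ∂(fbar r).fst +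
          ENNReal.ofReal L * 𝒦 r := hLedger1 (fbar r)
    calc ENNReal.ofReal |∫ y, F y ∂(fbar r)|
        ≤ ENNReal.ofReal K * ∫⁻ x, klDiv ((fbar r).condKernel x) (gaussMeasure (u₀ x) (θ₀ x)) ∂(fbar r).fst +
            ENNReal.ofReal L * 𝒦 r := h1r
      _ ≤ ENNReal.ofReal K * ENNReal.ofReal (c * h + δ) + ENNReal.ofReal L * 𝒦 r := by gcongr
      _ = ENNReal.ofReal (K * (c * h + δ)) + ENNReal.ofReal L * 𝒦 r := by
          rw [ENNReal.ofReal_mul hK.le]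
  /- (vii) integration over the window in `ℝ≥0∞`, and `C⁺` -/
  have hA0 : 0 ≤ K * (c * h + δ) := mul_nonneg hK.le (add_nonneg (mul_nonneg hc0.le hh0) hδpos.le)
  have he0 : 0 ≤ ε' * (h + 1) := mul_nonneg hε'pos.le (by linarith)
  set B : ℝ := K * (c * h + δ) + L * (ε' * (h + 1)) with hBdef
  clear_value B
  have hB0 : 0 ≤ B := by
    rw [hBdef]
    exact add_nonneg hA0 (mul_nonneg hL.le he0)
  have hwin : ∫⁻ r in Icc (0 : ℝ) w, ENNReal.ofReal |∫ y, F y ∂(fbar r)| ≤ ENNReal.ofReal (w * B) := by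
    have h4 := hN₁ N hN1 Q rfl fbar (fun r => rfl)
    have h4' : (ENNReal.ofReal w)⁻¹ * ∫⁻ r in Icc (0 : ℝ) w, 𝒦 r ≤
        ENNReal.ofReal ε' * (klDiv Q P / ((N : ℝ≥0∞) + 1) + 1) := h4
    rw [hKLof, lga_h4_rhs N hε'pos.le hKL0] at h4'
    have h4'' : ∫⁻ r in Icc (0 : ℝ) w, 𝒦 r ≤ ENNReal.ofReal w * ENNReal.ofReal (ε' * (h + 1)) :=
      lga_le_of_inv_mul_le hw h4'
    calc ∫⁻ r in Icc (0 : ℝ) w, ENNReal.ofReal |∫ y, F y ∂(fbar r)|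
        ≤ ENNReal.ofReal (K * (c * h + δ) * w) + ENNReal.ofReal L * ∫⁻ r in Icc (0 : ℝ) w, 𝒦 r :=
          lga_lintegral_affine_bound hA0 hper
      _ ≤ ENNReal.ofReal (K * (c * h + δ) * w) +
            ENNReal.ofReal L * (ENNReal.ofReal w * ENNReal.ofReal (ε' * (h + 1))) := by gcongr
      _ = ENNReal.ofReal (w * B) := by
          rw [hBdef]
          exact lga_window_collect hw.le hA0 hL.le he0
  have habs : |∫ r in Ioc (0 : ℝ) w, ∫ y, F y ∂(fbar r)| ≤ w * B :=
    lga_abs_setIntegral_le Ioc_subset_Icc_self (mul_nonneg hw.le hB0) hwin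
  /- (viii) the ledger arithmetic -/
  have hβES : β * ∫ z, S z ∂Q ≤ |β| * (((N : ℝ) + 1) * B) := by
    rw [hmean, intervalIntegral.integral_of_le hw.le]
    exact lga_scale_bound hw hNpos habs
  have hbr : |β| * B - h ≤ ε := by
    rw [hBdef]
    exact lga_ledger_arith hh0 hε.le hβKc hβLε1 hβLε2 hβKδ
  have hKid : KL = β * ∫ z, S z ∂Q - Real.log (∫ z, Real.exp (β * S z) ∂P) := by
    rw [hKLeq, integral_const_mul]
  have hlog : Real.log (∫ z, Real.exp (β * S z) ∂P) ≤ ε * ((N : ℝ) + 1) :=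
    lga_log_bound hKid hKLh hβES hbr hNpos.le
  /- conversion to the `∫⁻` form -/
  have hZpos : 0 < ∫ z, Real.exp (β * S z) ∂P := integral_exp_pos hexpβ
  have hgoal : ∫⁻ z, ENNReal.ofReal (Real.exp (β * S z)) ∂P ≤
      ENNReal.ofReal (Real.exp (ε * ((N : ℝ) + 1))) := by
    rw [← ofReal_integral_eq_lintegral_ofReal hexpβ (ae_of_all _ fun _ => (Real.exp_pos _).le)]
    refine ENNReal.ofReal_le_ofReal ?_
    rw [← Real.exp_log hZpos]
    exact Real.exp_le_exp.2 hlog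
  exact hgoal

end Summit.AtomisticToContinuum.HydrodynamicLimit.Theorems.KineticCurrentsWindowLDUniformLocalGibbs

end
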